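import Mathlib.RingTheory.Etale.Kaehler
import Mathlib.RingTheory.Etale.Field
import Mathlib.RingTheory.Derivation.Basic
import Mathlib.RingTheory.AlgebraicIndependent.TranscendenceBasis
import Mathlib.RingTheory.AlgebraicIndependent.AlgebraicClosure
import Mathlib.RingTheory.AlgebraicIndependent.Adjoin
import Mathlib.Algebra.MvPolynomial.PDeriv
import Mathlib.FieldTheory.Perfect
import Mathlib.FieldTheory.IntermediateField.Adjoin.Basic
import Literature.NumberTheory.Transcendental.AxDerivationTools
import HarnessLib

/-!
# Derivations of fields, II: extension along separable algebraic extensions, and the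
# partial derivative `∂/∂b` attached to a transcendental element

Trunk T-TRANSCEND (`Literature/NumberTheory/Transcendental`). Commutative-algebra support for
the transcendence input of Ax's theorem (J. Ax, *On Schanuel's conjectures*, Ann. of Math. 93
(1971), §2; M. Rosenlicht, Pacific J. Math. 65 (1976), Prop. 4), all folklore
(S. Lang, *Algebra*, Ch. VIII §5):

* `Literature.NumberTheory.Transcendental.exists_derivation_extend_of_formallyEtale`: an `R`-derivation `S → M` into a `T`-module
  extends to `T` when `T` is formally étale over `S` (Mathlib: `Ω[T⁄R] = T ⊗_S Ω[S⁄R]`,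
  `KaehlerDifferential.isBaseChange_of_formallyEtale`); in particular along every separable
  algebraic extension of fields (`Algebra.FormallyEtale.of_isSeparable`).
* `Literature.NumberTheory.Transcendental.exists_derivation_algEquiv_conj`: transport of a derivation `A → A` along `A ≃ₐ[R] B`.
* `Literature.NumberTheory.Transcendental.exists_derivation_of_transcendental`: for `b ∈ K` transcendental over a subfield `k`
  (characteristic `0`) there are an intermediate field `k₁` (generated by the rest of a
  transcendence basis through `b`) with `b` transcendental over `k₁` and `K` algebraic over
  `k₁(b)`, and a `k`-derivation `∂ = ∂/∂b` of `K` with `∂ b = 1`, `∂ = 0` on `k₁`, and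
  `∂(k₁(b)) ⊆ k₁(b)`.

## References

* S. Lang, *Algebra*, 3rd ed., GTM 211, Springer (2002), Ch. VIII §5 (Derivations).
* J. Ax, *On Schanuel's conjectures*, Ann. of Math. 93 (1971), 252–268, §2.
-/

noncomputable section

open scoped IntermediateField

namespace Literature.NumberTheory.Transcendental

/-! ### Extension of derivations along formally étale algebras -/

section Etale

variable {R S T M : Type*} [CommRing R] [CommRing S] [CommRing T] [Algebra R S] [Algebra R T]
  [Algebra S T] [IsScalarTower R S T] [AddCommGroup M] [Module T M] [Module S M] [Module R M]
  [IsScalarTower S T M] [IsScalarTower R T M]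

/-- **Derivations extend along formally étale algebras.** If `T` is a formally étale
`S`-algebra (e.g. a separable algebraic extension of fields) and `D : S → M` is an
`R`-derivation into a `T`-module, there is an `R`-derivation `D' : T → M` with `D' s = D s` on
`S`. Proof: `Ω[T⁄R]` is the base change `T ⊗_S Ω[S⁄R]`, so the `S`-linear map
`Ω[S⁄R] → M` of `D` extends to a `T`-linear map `Ω[T⁄R] → M`. [cite: Lang2002, Ch. VIII §5] -/
theorem exists_derivation_extend_of_formallyEtale [Algebra.FormallyEtale S T]
    [IsScalarTower R S M] (D : Derivation R S M) :
    ∃ D' : Derivation R T M, ∀ s : S, D' (algebraMap S T s) = D s := by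
  have h := KaehlerDifferential.isBaseChange_of_formallyEtale R S T
  let ℓ : Ω[T⁄R] →ₗ[T] M := h.lift D.liftKaehlerDifferential
  refine ⟨ℓ.compDer (KaehlerDifferential.D R T), fun s => ?_⟩
  change ℓ (KaehlerDifferential.D R T (algebraMap S T s)) = D s
  rw [← KaehlerDifferential.map_D R R S T s]
  change h.lift D.liftKaehlerDifferential (KaehlerDifferential.map R R S T _) = D s
  rw [IsBaseChange.lift_eq, Derivation.liftKaehlerDifferential_comp_D]

end Etale

/-! ### Transport of derivations along algebra isomorphisms -/

section Transport

variable {R A B : Type*} [CommRing R] [CommRing A] [CommRing B] [Algebra R A] [Algebra R B]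

/-- Transport of a derivation `D : A → A` along an `R`-algebra isomorphism `e : A ≃ B`: there
is a derivation `D'` of `B` with `D' (e a) = e (D a)`, namely `b ↦ e (D (e⁻¹ b))`. [folklore] -/
theorem exists_derivation_algEquiv_conj (e : A ≃ₐ[R] B) (D : Derivation R A A) :
    ∃ D' : Derivation R B B, ∀ a : A, D' (e a) = e (D a) := by
  let D' : Derivation R B B :=
    { toLinearMap := e.toLinearMap ∘ₗ (D : A →ₗ[R] A) ∘ₗ e.symm.toLinearMap
      map_one_eq_zero' := by
        change e (D (e.symm 1)) = 0
        rw [map_one, D.map_one_eq_zero, map_zero]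
      leibniz' := fun a b => by
        change e (D (e.symm (a * b))) = a • e (D (e.symm b)) + b • e (D (e.symm a))
        rw [map_mul, D.leibniz, map_add, smul_eq_mul, smul_eq_mul, map_mul, map_mul,
          e.apply_symm_apply, e.apply_symm_apply, smul_eq_mul, smul_eq_mul] }
  refine ⟨D', fun a => ?_⟩
  change e (D (e.symm (e a))) = e (D a)
  rw [e.symm_apply_apply]

end Transport

/-! ### The partial derivative `∂/∂b` attached to a transcendental element -/

section PartialDerivative

variable {k K : Type*} [Field k] [CharZero k] [Field K] [Algebra k K]

/-- **The derivation `∂/∂b`.** Let `k ⊆ K` be fields of characteristic zero and `b ∈ K`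
transcendental over `k`. Complete `{b}` to a transcendence basis `𝔅` of `K/k` and let
`k₁ = k(𝔅 ∖ {b})`. Then `b` is transcendental over `k₁`, `K` is algebraic over `k₁(b) = k(𝔅)`,
and there is a `k`-derivation `∂` of `K` with `∂ b = 1`, `∂ = 0` on `k₁` and
`∂(k₁(b)) ⊆ k₁(b)`: the partial derivative `∂/∂b` of `k[𝔅]`, extended to the fraction field
`k(𝔅)` and then (uniquely) to the separable algebraic extension `K`.
[cite: Lang2002, Ch. VIII §5] -/
theorem exists_derivation_of_transcendental {b : K} (hb : Transcendental k b) :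
    ∃ k₁ : IntermediateField k K, Transcendental k₁ b ∧ Algebra.IsAlgebraic k₁⟮b⟯ K ∧
      ∃ δ : Derivation k K K, δ b = 1 ∧ (∀ x ∈ k₁, δ x = 0) ∧
        ∀ x : K, x ∈ k₁⟮b⟯ → δ x ∈ k₁⟮b⟯ := by
  classical
  -- a transcendence basis `𝔅 ∋ b`
  have hb' : AlgebraicIndepOn k id ({b} : Set K) := by
    rw [AlgebraicIndepOn, algebraicIndependent_singleton_iff (⟨b, rfl⟩ : ({b} : Set K))]
    exact hb
  obtain ⟨𝔅, hb𝔅, h𝔅⟩ := exists_isTranscendenceBasis_superset hb'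
  have hbmem : b ∈ 𝔅 := hb𝔅 rfl
  set k₁ : IntermediateField k K := IntermediateField.adjoin k (𝔅 \ {b}) with hk₁
  set L₀ : IntermediateField k K := IntermediateField.adjoin k (Set.range ((↑) : 𝔅 → K))
    with hL₀
  have hrange : Set.range ((↑) : 𝔅 → K) = 𝔅 := Subtype.range_coe
  have hL₀' : (k₁⟮b⟯).restrictScalars k = L₀ := by
    rw [hk₁, IntermediateField.adjoin_adjoin_left, hL₀, hrange, Set.sdiff_union_self,
      Set.union_eq_left.mpr (Set.singleton_subset_iff.mpr hbmem)]
  have hmemL₀ : ∀ x : K, x ∈ k₁⟮b⟯ ↔ x ∈ L₀ := fun x => by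
    rw [← hL₀']; exact Iff.rfl
  -- `b` is transcendental over `k₁`
  have htr : Transcendental k₁ b := by
    rw [hk₁, IntermediateField.transcendental_adjoin_iff]
    have hs : ((↑) : 𝔅 → K) '' {j : 𝔅 | (j : K) ≠ b} = 𝔅 \ {b} := by
      ext x
      simp only [Set.mem_image, Set.mem_setOf_eq, Set.mem_sdiff, Set.mem_singleton_iff]
      constructor
      · rintro ⟨j, hj, rfl⟩; exact ⟨j.2, hj⟩
      · rintro ⟨hx, hxb⟩; exact ⟨⟨x, hx⟩, hxb, rfl⟩
    have := h𝔅.1.transcendental_adjoin (s := {j : 𝔅 | (j : K) ≠ b}) (i := ⟨b, hbmem⟩)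
      (by simp)
    rwa [hs] at this
  -- `K` is algebraic over `L₀ = k₁(b)`
  haveI hL₀alg : Algebra.IsAlgebraic L₀ K := h𝔅.isAlgebraic_field
  have halg : Algebra.IsAlgebraic k₁⟮b⟯ K := by
    have hle : L₀ ≤ (k₁⟮b⟯).restrictScalars k := hL₀'.ge
    letI : Algebra L₀ k₁⟮b⟯ := (IntermediateField.inclusion hle).toAlgebra
    haveI : IsScalarTower L₀ k₁⟮b⟯ K := IsScalarTower.of_algebraMap_eq fun _ => rfl
    exact Algebra.IsAlgebraic.tower_top (K := L₀) k₁⟮b⟯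
  refine ⟨k₁, htr, halg, ?_⟩
  -- the derivation `∂/∂b` on `k[𝔅] ≅ MvPolynomial 𝔅 k`, on `Frac = k(𝔅) ≅ L₀`
  set P := MvPolynomial 𝔅 k with hP
  set DP : Derivation k P P := MvPolynomial.pderiv ⟨b, hbmem⟩ with hDP
  set FR := FractionRing P with hFR
  obtain ⟨DF, hDF⟩ := exists_derivation_extend_of_isFractionRing (R := k) (A := P) (K := FR)
    ((Algebra.linearMap P FR).compDer DP)
  have hDF' : ∀ a : P, DF (algebraMap P FR a) = algebraMap P FR (DP a) := fun a => hDF a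
  set e : FR ≃ₐ[k] L₀ := h𝔅.1.aevalEquivField with he
  obtain ⟨δ₀, hδ₀⟩ := exists_derivation_algEquiv_conj e DF
  have hδ₀X : ∀ j : 𝔅, δ₀ ⟨j, IntermediateField.subset_adjoin k _ ⟨j, rfl⟩⟩ =
      e (algebraMap P FR (DP (MvPolynomial.X j))) := by
    intro j
    have hj : e (algebraMap P FR (MvPolynomial.X j)) =
        ⟨j, IntermediateField.subset_adjoin k _ ⟨j, rfl⟩⟩ := by
      apply Subtype.ext
      rw [he, AlgebraicIndependent.aevalEquivField_algebraMap_apply_coe, MvPolynomial.aeval_X]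
    rw [← hj, hδ₀, hDF']
  have hδ₀b : δ₀ ⟨b, IntermediateField.subset_adjoin k _ ⟨⟨b, hbmem⟩, rfl⟩⟩ = 1 := by
    rw [hδ₀X ⟨b, hbmem⟩, hDP, MvPolynomial.pderiv_X]
    simp
  have hδ₀j : ∀ j : 𝔅, (j : K) ≠ b →
      δ₀ ⟨j, IntermediateField.subset_adjoin k _ ⟨j, rfl⟩⟩ = 0 := by
    intro j hj
    rw [hδ₀X j, hDP, MvPolynomial.pderiv_X]
    have : (⟨b, hbmem⟩ : 𝔅) ≠ j := fun h => hj (congrArg Subtype.val h).symm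
    simp [Pi.single_eq_of_ne' this]
  -- `δ₀` vanishes on `k₁`
  have hδ₀k₁ : ∀ (x : K) (hx : x ∈ k₁) (hx' : x ∈ L₀), δ₀ ⟨x, hx'⟩ = 0 := by
    intro x hx
    rw [hk₁] at hx
    induction hx using IntermediateField.adjoin_induction with
    | mem x hx =>
      intro hx'
      obtain ⟨hx𝔅, hxb⟩ := hx
      exact hδ₀j ⟨x, hx𝔅⟩ hxb
    | algebraMap c => intro hx'; exact δ₀.map_algebraMap c
    | add x y hx hy ihx ihy =>
      intro hxy
      have hxL : x ∈ L₀ := (IntermediateField.adjoin.mono k _ _ Set.sdiff_subset) hx |> fun h => by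
        rw [hL₀, hrange]; exact h
      have hyL : y ∈ L₀ := (IntermediateField.adjoin.mono k _ _ Set.sdiff_subset) hy |> fun h => by
        rw [hL₀, hrange]; exact h
      have : (⟨x + y, hxy⟩ : L₀) = ⟨x, hxL⟩ + ⟨y, hyL⟩ := rfl
      rw [this, map_add, ihx hxL, ihy hyL, add_zero]
    | inv x hx ihx =>
      intro hx'
      have hxL : x ∈ L₀ := (IntermediateField.adjoin.mono k _ _ Set.sdiff_subset) hx |> fun h => by
        rw [hL₀, hrange]; exact h
      have : (⟨x⁻¹, hx'⟩ : L₀) = (⟨x, hxL⟩ : L₀)⁻¹ := rfl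
      rw [this, Derivation.leibniz_inv, ihx hxL, smul_zero]
    | mul x y hx hy ihx ihy =>
      intro hxy
      have hxL : x ∈ L₀ := (IntermediateField.adjoin.mono k _ _ Set.sdiff_subset) hx |> fun h => by
        rw [hL₀, hrange]; exact h
      have hyL : y ∈ L₀ := (IntermediateField.adjoin.mono k _ _ Set.sdiff_subset) hy |> fun h => by
        rw [hL₀, hrange]; exact h
      have : (⟨x * y, hxy⟩ : L₀) = ⟨x, hxL⟩ * ⟨y, hyL⟩ := rfl
      rw [this, Derivation.leibniz, ihx hxL, ihy hyL, smul_zero, smul_zero, add_zero]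
  -- extension to `K` along the separable algebraic extension `K / L₀`
  haveI : Algebra.IsSeparable L₀ K := Algebra.IsAlgebraic.isSeparable_of_perfectField
  haveI : Algebra.FormallyEtale L₀ K := Algebra.FormallyEtale.of_isSeparable L₀ K
  obtain ⟨δ, hδ⟩ := exists_derivation_extend_of_formallyEtale (R := k) (S := L₀) (T := K)
    ((Algebra.linearMap L₀ K).compDer δ₀)
  have hδ' : ∀ x : L₀, δ (x : K) = (δ₀ x : K) := fun x => hδ x
  refine ⟨δ, ?_, ?_, ?_⟩
  · have := hδ' ⟨b, IntermediateField.subset_adjoin k _ ⟨⟨b, hbmem⟩, rfl⟩⟩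
    rw [hδ₀b] at this
    simpa using this
  · intro x hx
    have hxL : x ∈ L₀ := by
      have : k₁ ≤ L₀ := by
        rw [hk₁, hL₀, hrange]; exact IntermediateField.adjoin.mono k _ _ Set.sdiff_subset
      exact this hx
    have := hδ' ⟨x, hxL⟩
    rw [hδ₀k₁ x hx hxL] at this
    simpa using this
  · intro x hx
    have hxL : x ∈ L₀ := (hmemL₀ x).mp hx
    rw [hmemL₀, show x = ((⟨x, hxL⟩ : L₀) : K) from rfl, hδ']
    exact (δ₀ ⟨x, hxL⟩).2

end PartialDerivative

end Literature.NumberTheory.Transcendental
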